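import Literature.Analysis.FluidPDE.PassiveVectorTensorDistortedDuality
import HarnessLib

/-!
# The two-member Duhamel identity for the distorted weak class: a distorted weak solution paired
# with an admissible field that solves the backward adjoint problem of a SECOND member
# (different carrier AND different tensor), with both cross terms and a residual

Analysis/FluidPDE proof-support file (everything proved; no definitions, no named facts). Sequel of
`PassiveVectorTensorDistortedDuality` (§3 there is the case of EQUAL carriers).

Let `w` be a weak solution of the `G`-DISTORTED class
`Torus.IsWeakTensorPassiveVectorDistortedOn A T 𝔸 b G w₀ w` (`∂ₜw + (b·∇)w + A (w·∇)b + Gᵀ∇π = 𝓛^G_𝔸 w`,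
`∇·(G w) = 0`; member 1: carrier `b`, tensor `𝔸`) and let `ψ` be an ADMISSIBLE FIELD on `[0,T]` — smooth
slices, all iterated space derivatives jointly continuous, Lipschitz in time uniformly in space,
`∇·(G(t) ψ(t)) = 0` for every `t`, with an a.e.-in-time derivative `ψ'` — that solves CLASSICALLY
(a.e. `t`, every `y`) the backward adjoint distorted problem of a SECOND member (carrier `b₂`, tensor
`𝔸₂`, the SAME frame `G` and coupling `A` against `b`) up to a space-smooth pressure `q` and a residual
field `R`:

  `ψ' + (b₂·∇)ψ + 𝓛^{G,*}_{𝔸₂} ψ + A (⟪b, ∂ⱼψ⟫)ⱼ = Gᵀ∇q + R`.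

* `IsWeakTensorPassiveVectorDistortedOn.ae_integral_inner_twoMember_eq` — **the two-member Duhamel
  identity**: for a.e. `t ∈ (0,T)`,

  `∫⟪w(t), ψ(t)⟫ = ∫⟪w₀, ψ(0)⟫ + ∫_{(0,t]} ∫ ⟪w, ((b − b₂)·∇)ψ + 𝓛^{G,*}_{𝔸 − 𝔸₂} ψ + R⟫`

  — the TRANSPORT cross term (carrier difference on the test), the VISCOUS cross term (tensor
  difference, divergence form, conjugated by `G`) and the residual; the pressure is killed by
  `∇·(G w) = 0`, the stretching terms cancel pointwise (`⟪b, (w·∇)ψ⟫ = ⟪w, (⟪b, ∂ⱼψ⟫)ⱼ⟫`). This is the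
  distorted twin of the flat two-problem duality (`PassiveVectorTensorTwoProblemDuality`, there weak × weak
  and modewise) for weak × CLASSICAL pairs, and the direct Duhamel identity
  `⟪U(0,t)x − T(0,t)x, ψ⟫ = ∫₀ᵗ ⟨U(0,s)x, ((b_U − b_T)·∇)ψ(s) + 𝓛^{G,*}_{𝔸_U − 𝔸_T} ψ(s)⟩ ds` of two distorted
  members in one moving constraint class `K_{G(τ)}`, tested with the adjoint solution `ψ(s)` of the second
  member (`R = 0`), once a producer of the admissible field `ψ(·)` is supplied (no `G′` appears: both
  members live in the same moving class). Integrability of the space–time integrands is an explicit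
  hypothesis (the class builds in no regularity of `G`), as in the parent file.
* `…ae_integral_inner_twoMember_eq_of_residual_eq_zero` — the case `R = 0` (exact adjoint solution of
  member 2).
* `…ae_integral_inner_twoMember_eq_of_continuous` — **the integrability hypotheses discharged** from
  jointly continuous data: `G` with `C¹` slices and `G`, `∂_yG` jointly continuous, `∇q`, `b₂`, `R`
  jointly continuous (§6 of the parent file + `integrable_inner_of_continuous`); the a.e. derivative `ψ'`
  is identified with `timeDeriv ψ` where it exists.
* (private) `convect_sub_carrier` — `((u − v)·∇)f = (u·∇)f − (v·∇)f` pointwise (linearity of `Df(x)`).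

Consumer: cell `ad-ideate`, K1L_D (`stmt-AnomalousDissipation-27980`), lead memo L24 §1 (O4) «DIRECT
DUHAMEL» for the J-cut distorted blocks (member 1 = cell member with the pristine cell drift, member 2 =
coarse member, drift-free in the frame, enhanced tensor), with the admissible adjoint field supplied by a
local binder or by the frame reading of a classical Eulerian adjoint solution.

## Mathlib / tree search

Tree: `PassiveVectorTensorDistortedDuality` (`ae_integral_inner_lipschitzField_eq` = the §2 pairing identity
this file starts from; `ae_integral_inner_adjoint_eq` = equal carriers; `viscAdjVar_add_tensor`,
`inner_convect_eq_inner_stretchAdj`, `ae_integral_inner_distort_transpose_gradient_eq_zero`, §6 integrability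
discharges `integrable_weakIntegrand_lipschitzField`, `integrable_inner_viscAdjVar_conj`,
`integrable_inner_distort_transpose_gradient`, `integrable_inner_convect`, `integrable_inner_of_continuous`),
`PassiveVectorTensorTwoProblemDuality` (flat, weak × weak, Fourier cross terms), `TorusLinearisedFormTruncation`
(`convect_sub` in the FIELD argument — here the CARRIER argument is needed). `rg "b₂" PassiveVectorTensorDistorted*`:
no two-carrier identity for the distorted class existed.

## References

* J.-L. Lions, E. Magenes, *Non-Homogeneous Boundary Value Problems and Applications* I (Springer 1972),
  Ch. 3 §4.3–4.4 (adjoint / transposition identity for linear parabolic problems). [`LionsMagenes1972`]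
* R. Temam, *Infinite-Dimensional Dynamical Systems in Mechanics and Physics*, 2nd ed. (Springer 1997),
  Ch. II §3.1–3.2, (3.2)–(3.5), Thm. 3.1 (a.e. form of the weak formulation in time). [`Temam1997`]
* R. J. DiPerna, P.-L. Lions, Invent. Math. 98 (1989), §II.1 (12)–(14) (weak linear transport–diffusion,
  test classes; the duality/commutator structure of two problems with different drifts). [`DiPernaLions1989`]
* M. Giaquinta, *Multiple integrals in the calculus of variations and nonlinear elliptic systems*
  (Princeton 1983), Ch. III §2 (2.1)–(2.3) (divergence-form systems with variable coefficients).
  [`Giaquinta1983MultipleIntegrals`]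
-/

noncomputable section

open MeasureTheory Set Filter Function TopologicalSpace
open scoped ENNReal NNReal InnerProductSpace ContDiff Topology

namespace Literature.Analysis.FluidPDE

namespace Torus

variable {d : Type*} [Fintype d] [DecidableEq d]

/-! ## §1 The convective derivative is linear in the carrier -/

omit [Fintype d] [DecidableEq d] in
/-- `((u − v)·∇)f (x) = (u·∇)f (x) − (v·∇)f (x)`: the convective derivative `Df(x)[·]` is linear in the
carrier (no regularity of `f` needed: `Torus.fderiv f x` is a linear map). [folklore] -/
private theorem convect_sub_carrier {F : Type*} [NormedAddCommGroup F] [NormedSpace ℝ F]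
    (u v : UnitAddTorus d → EuclideanSpace ℝ d) (f : UnitAddTorus d → F) (x : UnitAddTorus d) :
    FunctionSpaces.Torus.convect (u - v) f x =
      FunctionSpaces.Torus.convect u f x - FunctionSpaces.Torus.convect v f x := by
  simp only [FunctionSpaces.Torus.convect, Pi.sub_apply, map_sub]

omit [Fintype d] [DecidableEq d] in
/-- `(u·∇)f = ((u − v)·∇)f + (v·∇)f` pointwise (the carrier split used for the transport cross term).
[folklore] -/
private theorem convect_eq_convect_sub_add_convect {F : Type*} [NormedAddCommGroup F] [NormedSpace ℝ F]
    (u v : UnitAddTorus d → EuclideanSpace ℝ d) (f : UnitAddTorus d → F) (x : UnitAddTorus d) :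
    FunctionSpaces.Torus.convect u f x =
      FunctionSpaces.Torus.convect (u - v) f x + FunctionSpaces.Torus.convect v f x := by
  rw [convect_sub_carrier, sub_add_cancel]

/-! ## §2 The two-member Duhamel identity -/

section Duhamel

namespace IsWeakTensorPassiveVectorDistortedOn

variable {A T : ℝ} {𝔸 𝔸₂ : Visc4 d} {b b₂ w R : ℝ → UnitAddTorus d → EuclideanSpace ℝ d}
  {G : ℝ → UnitAddTorus d → Matrix d d ℝ} {w₀ : UnitAddTorus d → EuclideanSpace ℝ d}
  {ψ ψ' : ℝ → UnitAddTorus d → EuclideanSpace ℝ d} {q : ℝ → UnitAddTorus d → ℝ}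

omit [DecidableEq d] in
/-- `C¹` slices of `G` give `C¹` conjugated coefficients `y ↦ (𝔹^{G(t,y)}) i c l e` for every constant
tensor `𝔹`. [cite: Giaquinta1983MultipleIntegrals, Ch. III §2 eq. (2.1)-(2.3)] -/
theorem isContDiff_one_conj_of_slice (hG : ∀ t i j, FunctionSpaces.Torus.IsContDiff 1 (fun y => G t y i j))
    (t : ℝ) (𝔹 : Visc4 d) (i c l e : d) :
    FunctionSpaces.Torus.IsContDiff 1 (fun y => Visc4.conj (G t y) 𝔹 i c l e) := by
  simp only [Visc4.conj_apply]
  have hG' := hG t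
  unfold FunctionSpaces.Torus.IsContDiff at hG' ⊢
  exact ContDiff.sum fun a _ => ContDiff.sum fun b' _ => ((hG' c a).mul contDiff_const).mul (hG' e b')

/-- **The pointwise reduction of the weak integrand by the adjoint equation of member 2.** If at `(t, y)`
`ψ' + (b₂·∇)ψ + 𝓛^{G,*}_{𝔸₂}ψ + A (⟪b, ∂ⱼψ⟫)ⱼ = Gᵀ∇q + R`, then
`⟪w, ψ' + (b·∇)ψ + 𝓛^{G,*}_𝔸 ψ⟫ + A⟪b, (w·∇)ψ⟫ = ⟪w, Gᵀ∇q⟫ + ⟪w, ((b − b₂)·∇)ψ + 𝓛^{G,*}_{𝔸−𝔸₂}ψ + R⟫`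
(split the carrier and the tensor, move the stretching term to the test side).
[cite: LionsMagenes1972, Ch. 3 §4.3–4.4] [cite: Temam1997, Ch. II §3.1–3.2, (3.2)–(3.5), Thm. 3.1] -/
theorem weakIntegrand_eq_of_adjoint₂ (hG : ∀ t i j, FunctionSpaces.Torus.IsContDiff 1 (fun y => G t y i j))
    (hψs : ∀ t, FunctionSpaces.Torus.IsSmooth (ψ t)) {t : ℝ} {y : UnitAddTorus d}
    (hadj : ψ' t y + FunctionSpaces.Torus.convect (b₂ t) (ψ t) y + viscAdjVar (fun y => Visc4.conj (G t y) 𝔸₂) (ψ t) y +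
          A • (WithLp.toLp 2 fun j => ⟪b t y, FunctionSpaces.Torus.partialDeriv j (ψ t) y⟫_ℝ) =
        distort (fun y => (G t y).transpose) (FunctionSpaces.Torus.gradient (q t)) y + R t y) :
    ⟪w t y, ψ' t y + FunctionSpaces.Torus.convect (b t) (ψ t) y + viscAdjVar (fun y => Visc4.conj (G t y) 𝔸) (ψ t) y⟫_ℝ +
        A * ⟪b t y, FunctionSpaces.Torus.convect (w t) (ψ t) y⟫_ℝ =
      ⟪w t y, distort (fun y => (G t y).transpose) (FunctionSpaces.Torus.gradient (q t)) y⟫_ℝ +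
        ⟪w t y, FunctionSpaces.Torus.convect (b t - b₂ t) (ψ t) y +
          viscAdjVar (fun y => Visc4.conj (G t y) (𝔸 - 𝔸₂)) (ψ t) y + R t y⟫_ℝ := by
  have hψ1 : FunctionSpaces.Torus.IsContDiff 1 (ψ t) := (hψs t).isContDiff (by simp)
  -- split the tensor: `𝔸^G = 𝔸₂^G + (𝔸 − 𝔸₂)^G`
  have hconj : (fun y => Visc4.conj (G t y) 𝔸) = fun y => Visc4.conj (G t y) 𝔸₂ + Visc4.conj (G t y) (𝔸 - 𝔸₂) := by
    funext y
    rw [← Visc4.conj_add, add_sub_cancel]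
  have hsplitV : viscAdjVar (fun y => Visc4.conj (G t y) 𝔸) (ψ t) y =
      viscAdjVar (fun y => Visc4.conj (G t y) 𝔸₂) (ψ t) y + viscAdjVar (fun y => Visc4.conj (G t y) (𝔸 - 𝔸₂)) (ψ t) y := by
    rw [hconj]
    exact viscAdjVar_add_tensor (isContDiff_one_conj_of_slice hG t 𝔸₂) (isContDiff_one_conj_of_slice hG t (𝔸 - 𝔸₂)) (hψs t) y
  -- split the carrier: `(b·∇)ψ = ((b − b₂)·∇)ψ + (b₂·∇)ψ`
  have hsplitC := convect_eq_convect_sub_add_convect (b t) (b₂ t) (ψ t) y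
  -- the stretching term on the test side
  have hstretch := inner_convect_eq_inner_stretchAdj (b := b t) (w := w t) hψ1 y
  -- regroup: `ψ' + (b·∇)ψ + 𝓛_𝔸ψ = (ψ' + (b₂·∇)ψ + 𝓛_{𝔸₂}ψ + A S) − A S + ((b−b₂)·∇)ψ + 𝓛_{𝔸−𝔸₂}ψ`
  have e1 : ψ' t y + FunctionSpaces.Torus.convect (b t) (ψ t) y + viscAdjVar (fun y => Visc4.conj (G t y) 𝔸) (ψ t) y =
      (distort (fun y => (G t y).transpose) (FunctionSpaces.Torus.gradient (q t)) y + R t y -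
          A • (WithLp.toLp 2 fun j => ⟪b t y, FunctionSpaces.Torus.partialDeriv j (ψ t) y⟫_ℝ)) +
        (FunctionSpaces.Torus.convect (b t - b₂ t) (ψ t) y +
          viscAdjVar (fun y => Visc4.conj (G t y) (𝔸 - 𝔸₂)) (ψ t) y) := by
    rw [hsplitV, hsplitC, ← hadj]
    abel
  rw [e1, hstretch]
  simp only [inner_add_right, inner_sub_right, inner_smul_right]
  ring

/-- **THE TWO-MEMBER DUHAMEL IDENTITY for the distorted class.** Let `w` be a distorted weak solution
(member 1: tensor `𝔸`, carrier `b`, frame `G`, coupling `A`, datum `w₀`) and let `ψ` be an admissible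
field on `[0,T]` (smooth slices, all iterated space derivatives jointly continuous, time-Lipschitz
uniformly in space, `∇·(G ψ) = 0`, a.e.-in-time derivative `ψ'`) solving CLASSICALLY, for a.e. `t` and
every `y`, the backward adjoint problem of member 2 (carrier `b₂`, tensor `𝔸₂`, same `G`, coupling `A`
against `b`) with a space-smooth pressure `q` and a residual `R`:
`ψ' + (b₂·∇)ψ + 𝓛^{G,*}_{𝔸₂} ψ + A (⟪b, ∂ⱼψ⟫)ⱼ = Gᵀ∇q + R`. Then for a.e. `t ∈ (0,T)`,

  `∫⟪w(t), ψ(t)⟫ = ∫⟪w₀, ψ(0)⟫ + ∫_{(0,t]} ∫ ⟪w, ((b − b₂)·∇)ψ + 𝓛^{G,*}_{𝔸−𝔸₂} ψ + R⟫`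

(the pressure is killed by `∇·(G w) = 0`; the three space–time integrands are assumed integrable and
`G(t,·) ∈ C¹`). With `b₂ = b` this is `ae_integral_inner_adjoint_eq` of the parent file (plus the
residual); with `R = 0` it is the direct Duhamel identity of two distorted members in one moving
constraint class, tested with the adjoint solution of the second.
[cite: LionsMagenes1972, Ch. 3 §4.3–4.4] [cite: Temam1997, Ch. II §3.1–3.2, (3.2)–(3.5), Thm. 3.1] [cite: DiPernaLions1989, §II.1 (12)–(14)] -/
theorem ae_integral_inner_twoMember_eq (h : IsWeakTensorPassiveVectorDistortedOn A T 𝔸 b G w₀ w)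
    (hψs : ∀ t, FunctionSpaces.Torus.IsSmooth (ψ t))
    (hψc : ∀ l : List d, Continuous (uncurry fun t y => FunctionSpaces.Torus.iterPartialDeriv l (ψ t) y))
    (hψL : ∃ L : ℝ, 0 ≤ L ∧ ∀ t ∈ Icc 0 T, ∀ s ∈ Icc 0 T, ∀ y, ‖ψ t y - ψ s y‖ ≤ L * |t - s|)
    (hψdiv : ∀ t, FunctionSpaces.Torus.IsDivFree (distort (G t) (ψ t)))
    (hψ' : ∀ᵐ t ∂(volume.restrict (Ioo 0 T)), ∀ y, HasDerivAt (fun s => ψ s y) (ψ' t y) t)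
    (hG : ∀ t i j, FunctionSpaces.Torus.IsContDiff 1 (fun y => G t y i j)) (hq : ∀ t, FunctionSpaces.Torus.IsSmooth (q t))
    (hadj : ∀ᵐ t ∂(volume.restrict (Ioo 0 T)), ∀ y,
      ψ' t y + FunctionSpaces.Torus.convect (b₂ t) (ψ t) y + viscAdjVar (fun y => Visc4.conj (G t y) 𝔸₂) (ψ t) y +
          A • (WithLp.toLp 2 fun j => ⟪b t y, FunctionSpaces.Torus.partialDeriv j (ψ t) y⟫_ℝ) =
        distort (fun y => (G t y).transpose) (FunctionSpaces.Torus.gradient (q t)) y + R t y)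
    (hint : Integrable (fun p : ℝ × UnitAddTorus d =>
      ⟪w p.1 p.2, ψ' p.1 p.2 + FunctionSpaces.Torus.convect (b p.1) (ψ p.1) p.2 +
          viscAdjVar (fun y => Visc4.conj (G p.1 y) 𝔸) (ψ p.1) p.2⟫_ℝ +
        A * ⟪b p.1 p.2, FunctionSpaces.Torus.convect (w p.1) (ψ p.1) p.2⟫_ℝ)
      (((volume : Measure ℝ).restrict (Ioo 0 T)).prod volume))
    (hintX : Integrable (fun p : ℝ × UnitAddTorus d =>
      ⟪w p.1 p.2, FunctionSpaces.Torus.convect (b p.1 - b₂ p.1) (ψ p.1) p.2 +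
          viscAdjVar (fun y => Visc4.conj (G p.1 y) (𝔸 - 𝔸₂)) (ψ p.1) p.2 + R p.1 p.2⟫_ℝ)
      (((volume : Measure ℝ).restrict (Ioo 0 T)).prod volume))
    (hintQ : Integrable (fun p : ℝ × UnitAddTorus d =>
      ⟪w p.1 p.2, distort (fun y => (G p.1 y).transpose) (FunctionSpaces.Torus.gradient (q p.1)) p.2⟫_ℝ)
      (((volume : Measure ℝ).restrict (Ioo 0 T)).prod volume)) :
    ∀ᵐ t ∂(volume.restrict (Ioo 0 T)),
      ∫ x, ⟪w t x, ψ t x⟫_ℝ = (∫ x, ⟪w₀ x, ψ 0 x⟫_ℝ) +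
        ∫ τ in Ioc 0 t, ∫ x, ⟪w τ x, FunctionSpaces.Torus.convect (b τ - b₂ τ) (ψ τ) x +
          viscAdjVar (fun y => Visc4.conj (G τ y) (𝔸 - 𝔸₂)) (ψ τ) x + R τ x⟫_ℝ := by
  have h1 := h.ae_integral_inner_lipschitzField_eq hψs hψc hψL hψdiv hψ' hint
  -- the pointwise reduction of the integrand, a.e. `t`, every `y`
  have hpt : ∀ᵐ t ∂(volume.restrict (Ioo 0 T)), ∀ y,
      ⟪w t y, ψ' t y + FunctionSpaces.Torus.convect (b t) (ψ t) y + viscAdjVar (fun y => Visc4.conj (G t y) 𝔸) (ψ t) y⟫_ℝ +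
          A * ⟪b t y, FunctionSpaces.Torus.convect (w t) (ψ t) y⟫_ℝ =
        ⟪w t y, distort (fun y => (G t y).transpose) (FunctionSpaces.Torus.gradient (q t)) y⟫_ℝ +
          ⟪w t y, FunctionSpaces.Torus.convect (b t - b₂ t) (ψ t) y +
            viscAdjVar (fun y => Visc4.conj (G t y) (𝔸 - 𝔸₂)) (ψ t) y + R t y⟫_ℝ := by
    filter_upwards [hadj] with t ht y
    exact weakIntegrand_eq_of_adjoint₂ hG hψs (ht y)
  -- slice integrability and the reduced space integral, a.e. `t`
  have hQ0 := h.ae_integral_inner_distort_transpose_gradient_eq_zero hq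
  have hred : ∀ᵐ t ∂(volume.restrict (Ioo 0 T)),
      (∫ y, (⟪w t y, ψ' t y + FunctionSpaces.Torus.convect (b t) (ψ t) y +
          viscAdjVar (fun y => Visc4.conj (G t y) 𝔸) (ψ t) y⟫_ℝ +
        A * ⟪b t y, FunctionSpaces.Torus.convect (w t) (ψ t) y⟫_ℝ)) =
      ∫ y, ⟪w t y, FunctionSpaces.Torus.convect (b t - b₂ t) (ψ t) y +
          viscAdjVar (fun y => Visc4.conj (G t y) (𝔸 - 𝔸₂)) (ψ t) y + R t y⟫_ℝ := by
    filter_upwards [hpt, hQ0, hintX.prod_right_ae, hintQ.prod_right_ae] with t ht h0 hX hQi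
    rw [integral_congr_ae (Eventually.of_forall ht), integral_add hQi hX, h0, zero_add]
  -- the time integrals agree on every `(0,t]`, `t ∈ (0,T)`
  filter_upwards [h1, ae_restrict_mem measurableSet_Ioo] with t ht htT
  rw [ht]
  congr 1
  refine setIntegral_congr_ae measurableSet_Ioc ?_
  have hsub : ∀ᵐ τ ∂(volume : Measure ℝ), τ ∈ Ioo 0 T → τ ∈ Ioc 0 t →
      (∫ y, (⟪w τ y, ψ' τ y + FunctionSpaces.Torus.convect (b τ) (ψ τ) y +
          viscAdjVar (fun y => Visc4.conj (G τ y) 𝔸) (ψ τ) y⟫_ℝ +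
        A * ⟪b τ y, FunctionSpaces.Torus.convect (w τ) (ψ τ) y⟫_ℝ)) =
      ∫ y, ⟪w τ y, FunctionSpaces.Torus.convect (b τ - b₂ τ) (ψ τ) y +
          viscAdjVar (fun y => Visc4.conj (G τ y) (𝔸 - 𝔸₂)) (ψ τ) y + R τ y⟫_ℝ := by
    have := (ae_restrict_iff' measurableSet_Ioo).1 hred
    filter_upwards [this] with τ hτ hτT _
    exact hτ hτT
  filter_upwards [hsub] with τ hτ hτt
  exact hτ ⟨hτt.1, lt_of_le_of_lt hτt.2 htT.2⟩ hτt

/-- **The case `R = 0`** (exact classical adjoint solution of member 2):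
`∫⟪w(t), ψ(t)⟫ = ∫⟪w₀, ψ(0)⟫ + ∫_{(0,t]} ∫ ⟪w, ((b − b₂)·∇)ψ + 𝓛^{G,*}_{𝔸−𝔸₂} ψ⟫` for a.e. `t ∈ (0,T)` —
the transport and viscous CROSS TERMS only.
[cite: LionsMagenes1972, Ch. 3 §4.3–4.4] [cite: Temam1997, Ch. II §3.1–3.2, (3.2)–(3.5), Thm. 3.1] -/
theorem ae_integral_inner_twoMember_eq_of_residual_eq_zero (h : IsWeakTensorPassiveVectorDistortedOn A T 𝔸 b G w₀ w)
    (hψs : ∀ t, FunctionSpaces.Torus.IsSmooth (ψ t))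
    (hψc : ∀ l : List d, Continuous (uncurry fun t y => FunctionSpaces.Torus.iterPartialDeriv l (ψ t) y))
    (hψL : ∃ L : ℝ, 0 ≤ L ∧ ∀ t ∈ Icc 0 T, ∀ s ∈ Icc 0 T, ∀ y, ‖ψ t y - ψ s y‖ ≤ L * |t - s|)
    (hψdiv : ∀ t, FunctionSpaces.Torus.IsDivFree (distort (G t) (ψ t)))
    (hψ' : ∀ᵐ t ∂(volume.restrict (Ioo 0 T)), ∀ y, HasDerivAt (fun s => ψ s y) (ψ' t y) t)
    (hG : ∀ t i j, FunctionSpaces.Torus.IsContDiff 1 (fun y => G t y i j)) (hq : ∀ t, FunctionSpaces.Torus.IsSmooth (q t))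
    (hadj : ∀ᵐ t ∂(volume.restrict (Ioo 0 T)), ∀ y,
      ψ' t y + FunctionSpaces.Torus.convect (b₂ t) (ψ t) y + viscAdjVar (fun y => Visc4.conj (G t y) 𝔸₂) (ψ t) y +
          A • (WithLp.toLp 2 fun j => ⟪b t y, FunctionSpaces.Torus.partialDeriv j (ψ t) y⟫_ℝ) =
        distort (fun y => (G t y).transpose) (FunctionSpaces.Torus.gradient (q t)) y)
    (hint : Integrable (fun p : ℝ × UnitAddTorus d =>
      ⟪w p.1 p.2, ψ' p.1 p.2 + FunctionSpaces.Torus.convect (b p.1) (ψ p.1) p.2 +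
          viscAdjVar (fun y => Visc4.conj (G p.1 y) 𝔸) (ψ p.1) p.2⟫_ℝ +
        A * ⟪b p.1 p.2, FunctionSpaces.Torus.convect (w p.1) (ψ p.1) p.2⟫_ℝ)
      (((volume : Measure ℝ).restrict (Ioo 0 T)).prod volume))
    (hintX : Integrable (fun p : ℝ × UnitAddTorus d =>
      ⟪w p.1 p.2, FunctionSpaces.Torus.convect (b p.1 - b₂ p.1) (ψ p.1) p.2 +
          viscAdjVar (fun y => Visc4.conj (G p.1 y) (𝔸 - 𝔸₂)) (ψ p.1) p.2⟫_ℝ)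
      (((volume : Measure ℝ).restrict (Ioo 0 T)).prod volume))
    (hintQ : Integrable (fun p : ℝ × UnitAddTorus d =>
      ⟪w p.1 p.2, distort (fun y => (G p.1 y).transpose) (FunctionSpaces.Torus.gradient (q p.1)) p.2⟫_ℝ)
      (((volume : Measure ℝ).restrict (Ioo 0 T)).prod volume)) :
    ∀ᵐ t ∂(volume.restrict (Ioo 0 T)),
      ∫ x, ⟪w t x, ψ t x⟫_ℝ = (∫ x, ⟪w₀ x, ψ 0 x⟫_ℝ) +
        ∫ τ in Ioc 0 t, ∫ x, ⟪w τ x, FunctionSpaces.Torus.convect (b τ - b₂ τ) (ψ τ) x +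
          viscAdjVar (fun y => Visc4.conj (G τ y) (𝔸 - 𝔸₂)) (ψ τ) x⟫_ℝ := by
  have hadj' : ∀ᵐ t ∂(volume.restrict (Ioo 0 T)), ∀ y,
      ψ' t y + FunctionSpaces.Torus.convect (b₂ t) (ψ t) y + viscAdjVar (fun y => Visc4.conj (G t y) 𝔸₂) (ψ t) y +
          A • (WithLp.toLp 2 fun j => ⟪b t y, FunctionSpaces.Torus.partialDeriv j (ψ t) y⟫_ℝ) =
        distort (fun y => (G t y).transpose) (FunctionSpaces.Torus.gradient (q t)) y +
          (fun (_ : ℝ) (_ : UnitAddTorus d) => (0 : EuclideanSpace ℝ d)) t y := by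
    filter_upwards [hadj] with t ht y
    rw [ht y, add_zero]
  have hintX' : Integrable (fun p : ℝ × UnitAddTorus d =>
      ⟪w p.1 p.2, FunctionSpaces.Torus.convect (b p.1 - b₂ p.1) (ψ p.1) p.2 +
          viscAdjVar (fun y => Visc4.conj (G p.1 y) (𝔸 - 𝔸₂)) (ψ p.1) p.2 +
          (fun (_ : ℝ) (_ : UnitAddTorus d) => (0 : EuclideanSpace ℝ d)) p.1 p.2⟫_ℝ)
      (((volume : Measure ℝ).restrict (Ioo 0 T)).prod volume) := by
    simpa only [add_zero] using hintX
  have hmain := h.ae_integral_inner_twoMember_eq hψs hψc hψL hψdiv hψ' hG hq hadj' hint hintX' hintQ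
  filter_upwards [hmain] with t ht
  simpa only [add_zero] using ht

end IsWeakTensorPassiveVectorDistortedOn

end Duhamel

/-! ## §3 Discharging the integrability hypotheses from jointly continuous data -/

section Integrability

namespace IsWeakTensorPassiveVectorDistortedOn

variable {A T : ℝ} {𝔸 𝔸₂ : Visc4 d} {b b₂ w R : ℝ → UnitAddTorus d → EuclideanSpace ℝ d}
  {G : ℝ → UnitAddTorus d → Matrix d d ℝ} {w₀ : UnitAddTorus d → EuclideanSpace ℝ d}
  {ψ ψ' : ℝ → UnitAddTorus d → EuclideanSpace ℝ d} {q : ℝ → UnitAddTorus d → ℝ}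

omit [DecidableEq d] in
/-- Almost every point of `(0,T) × 𝕋^d` (restricted product measure) has time coordinate in `(0,T)`.
[folklore]
-- adapted from `Literature/Analysis/FluidPDE/PassiveVectorTensorDistortedDuality.lean` (private there) -/
private theorem ae_fst_mem_Ioo₆ (T : ℝ) :
    ∀ᵐ p : ℝ × UnitAddTorus d ∂(((volume : Measure ℝ).restrict (Ioo 0 T)).prod volume),
      p.1 ∈ Ioo 0 T :=
  (Measure.quasiMeasurePreserving_fst (μ := (volume : Measure ℝ).restrict (Ioo 0 T))
    (ν := (volume : Measure (UnitAddTorus d)))).ae (ae_restrict_mem measurableSet_Ioo)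

/-- The convective derivative of an admissible field along a jointly continuous carrier is jointly
continuous: `(t, y) ↦ ((v t)·∇)(ψ t)(y) = Σⱼ (v t y)ⱼ ∂ⱼ(ψ t)(y)`. [cite: DiPernaLions1989, §II.1 (12)–(14)] -/
theorem continuous_uncurry_convect_of_continuous {v : ℝ → UnitAddTorus d → EuclideanSpace ℝ d}
    (hv : Continuous (uncurry v)) (hψs : ∀ t, FunctionSpaces.Torus.IsSmooth (ψ t))
    (hψd : ∀ j, Continuous (uncurry fun t x => FunctionSpaces.Torus.partialDeriv j (ψ t) x)) :
    Continuous (uncurry fun t x => FunctionSpaces.Torus.convect (v t) (ψ t) x) := by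
  have hψ1 : ∀ t, FunctionSpaces.Torus.IsContDiff 1 (ψ t) := fun t => (hψs t).isContDiff (by simp)
  have e : (uncurry fun t x => FunctionSpaces.Torus.convect (v t) (ψ t) x) =
      fun p : ℝ × UnitAddTorus d => ∑ j, (v p.1 p.2) j • FunctionSpaces.Torus.partialDeriv j (ψ p.1) p.2 := by
    funext p
    simp only [uncurry]
    rw [FunctionSpaces.Torus.convect_eq_sum_smul_partialDeriv (hψ1 p.1)]
  rw [e]
  refine continuous_finsetSum _ fun j _ => ?_
  have hvj : Continuous fun p : ℝ × UnitAddTorus d => (v p.1 p.2) j :=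
    (EuclideanSpace.proj j).continuous.comp hv
  exact hvj.smul (hψd j)

/-- **Discharge of `hintX`**: the cross integrand `⟪w, ((b − b₂)·∇)ψ + 𝓛^{G,*}_{𝔸−𝔸₂} ψ + R⟫` is
integrable on `(0,T) × T^d` for an admissible field `ψ`, a jointly continuous second carrier `b₂` and
residual `R`, and `G` with `C¹` slices and `G`, `∂_yG` jointly continuous (the class carrier's transport
pairing is integrable by `integrable_inner_convect`). [cite: DiPernaLions1989, §II.1 (12)–(14)] -/
theorem integrable_crossIntegrand (h : IsWeakTensorPassiveVectorDistortedOn A T 𝔸 b G w₀ w)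
    (hψs : ∀ t, FunctionSpaces.Torus.IsSmooth (ψ t))
    (hψc : ∀ l : List d, Continuous (uncurry fun t y => FunctionSpaces.Torus.iterPartialDeriv l (ψ t) y))
    (hG1 : ∀ t i j, FunctionSpaces.Torus.IsContDiff 1 (fun y => G t y i j))
    (hGc : ∀ i j, Continuous (uncurry fun t y => G t y i j))
    (hGd : ∀ i j e', Continuous (uncurry fun t y => FunctionSpaces.Torus.partialDeriv e' (fun y => G t y i j) y))
    (hb₂ : Continuous (uncurry b₂)) (hR : Continuous (uncurry R)) (𝔹₀ : Visc4 d) :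
    Integrable (fun p : ℝ × UnitAddTorus d =>
      ⟪w p.1 p.2, FunctionSpaces.Torus.convect (b p.1 - b₂ p.1) (ψ p.1) p.2 +
          viscAdjVar (fun y => Visc4.conj (G p.1 y) 𝔹₀) (ψ p.1) p.2 + R p.1 p.2⟫_ℝ)
      (((volume : Measure ℝ).restrict (Ioo 0 T)).prod volume) := by
  have hψ1 : ∀ t, FunctionSpaces.Torus.IsContDiff 1 (ψ t) := fun t => (hψs t).isContDiff (by simp)
  have hψd : ∀ j, Continuous (uncurry fun t x => FunctionSpaces.Torus.partialDeriv j (ψ t) x) :=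
    fun j => by simpa using hψc [j]
  have e : (fun p : ℝ × UnitAddTorus d =>
      ⟪w p.1 p.2, FunctionSpaces.Torus.convect (b p.1 - b₂ p.1) (ψ p.1) p.2 +
          viscAdjVar (fun y => Visc4.conj (G p.1 y) 𝔹₀) (ψ p.1) p.2 + R p.1 p.2⟫_ℝ) =
      fun p => ⟪w p.1 p.2, FunctionSpaces.Torus.convect (b p.1) (ψ p.1) p.2⟫_ℝ -
        ⟪w p.1 p.2, (fun t x => FunctionSpaces.Torus.convect (b₂ t) (ψ t) x) p.1 p.2⟫_ℝ +
        ⟪w p.1 p.2, (fun t x => viscAdjVar (fun y => Visc4.conj (G t y) 𝔹₀) (ψ t) x) p.1 p.2⟫_ℝ +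
        ⟪w p.1 p.2, R p.1 p.2⟫_ℝ := by
    funext p
    rw [inner_add_right, inner_add_right, convect_sub_carrier, inner_sub_right]
  rw [e]
  exact (((h.integrable_inner_convect hψ1 hψd).sub
    (h.integrable_inner_of_continuous (continuous_uncurry_convect_of_continuous hb₂ hψs hψd))).add
    (h.integrable_inner_viscAdjVar_conj hψs hψc hG1 hGc hGd 𝔹₀)).add (h.integrable_inner_of_continuous hR)

/-- **The two-member Duhamel identity with the integrability hypotheses discharged** from jointly
continuous data: `G` with `C¹` slices and `G`, `∂_yG` jointly continuous, `∇q`, `b₂`, `R` jointly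
continuous. The a.e. time derivative `ψ'` is identified with `timeDeriv ψ` wherever it exists, so the
integrability discharge `integrable_weakIntegrand_lipschitzField` (stated for `timeDeriv ψ`) applies.
[cite: LionsMagenes1972, Ch. 3 §4.3–4.4] [cite: Temam1997, Ch. II §3.1–3.2, (3.2)–(3.5), Thm. 3.1] [cite: DiPernaLions1989, §II.1 (12)–(14)] -/
theorem ae_integral_inner_twoMember_eq_of_continuous (h : IsWeakTensorPassiveVectorDistortedOn A T 𝔸 b G w₀ w)
    (hψs : ∀ t, FunctionSpaces.Torus.IsSmooth (ψ t))
    (hψc : ∀ l : List d, Continuous (uncurry fun t y => FunctionSpaces.Torus.iterPartialDeriv l (ψ t) y))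
    (hψL : ∃ L : ℝ, 0 ≤ L ∧ ∀ t ∈ Icc 0 T, ∀ s ∈ Icc 0 T, ∀ y, ‖ψ t y - ψ s y‖ ≤ L * |t - s|)
    (hψdiv : ∀ t, FunctionSpaces.Torus.IsDivFree (distort (G t) (ψ t)))
    (hψ' : ∀ᵐ t ∂(volume.restrict (Ioo 0 T)), ∀ y, HasDerivAt (fun s => ψ s y) (ψ' t y) t)
    (hG1 : ∀ t i j, FunctionSpaces.Torus.IsContDiff 1 (fun y => G t y i j))
    (hGc : ∀ i j, Continuous (uncurry fun t y => G t y i j))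
    (hGd : ∀ i j e', Continuous (uncurry fun t y => FunctionSpaces.Torus.partialDeriv e' (fun y => G t y i j) y))
    (hq : ∀ t, FunctionSpaces.Torus.IsSmooth (q t))
    (hqc : Continuous (uncurry fun t y => FunctionSpaces.Torus.gradient (q t) y))
    (hb₂ : Continuous (uncurry b₂)) (hR : Continuous (uncurry R))
    (hadj : ∀ᵐ t ∂(volume.restrict (Ioo 0 T)), ∀ y,
      ψ' t y + FunctionSpaces.Torus.convect (b₂ t) (ψ t) y + viscAdjVar (fun y => Visc4.conj (G t y) 𝔸₂) (ψ t) y +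
          A • (WithLp.toLp 2 fun j => ⟪b t y, FunctionSpaces.Torus.partialDeriv j (ψ t) y⟫_ℝ) =
        distort (fun y => (G t y).transpose) (FunctionSpaces.Torus.gradient (q t)) y + R t y) :
    ∀ᵐ t ∂(volume.restrict (Ioo 0 T)),
      ∫ x, ⟪w t x, ψ t x⟫_ℝ = (∫ x, ⟪w₀ x, ψ 0 x⟫_ℝ) +
        ∫ τ in Ioc 0 t, ∫ x, ⟪w τ x, FunctionSpaces.Torus.convect (b τ - b₂ τ) (ψ τ) x +
          viscAdjVar (fun y => Visc4.conj (G τ y) (𝔸 - 𝔸₂)) (ψ τ) x + R τ x⟫_ℝ := by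
  -- `ψ'` agrees with `timeDeriv ψ` a.e. in `t`, for every `y`
  have hψ'eq : ∀ᵐ t ∂(volume.restrict (Ioo 0 T)), ∀ y, ψ' t y = FunctionSpaces.Torus.timeDeriv ψ t y := by
    filter_upwards [hψ'] with t ht y
    exact ((ht y).deriv).symm
  -- integrability of the full weak integrand with `timeDeriv ψ`, transported to `ψ'`
  have hintD := h.integrable_weakIntegrand_lipschitzField hψs hψc hψL hG1 hGc hGd 𝔸
  have hint : Integrable (fun p : ℝ × UnitAddTorus d =>
      ⟪w p.1 p.2, ψ' p.1 p.2 + FunctionSpaces.Torus.convect (b p.1) (ψ p.1) p.2 +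
          viscAdjVar (fun y => Visc4.conj (G p.1 y) 𝔸) (ψ p.1) p.2⟫_ℝ +
        A * ⟪b p.1 p.2, FunctionSpaces.Torus.convect (w p.1) (ψ p.1) p.2⟫_ℝ)
      (((volume : Measure ℝ).restrict (Ioo 0 T)).prod volume) := by
    refine hintD.congr ?_
    have hprod : ∀ᵐ p : ℝ × UnitAddTorus d ∂(((volume : Measure ℝ).restrict (Ioo 0 T)).prod volume),
        ψ' p.1 p.2 = FunctionSpaces.Torus.timeDeriv ψ p.1 p.2 := by
      have hset : ∀ᵐ p : ℝ × UnitAddTorus d ∂(((volume : Measure ℝ).restrict (Ioo 0 T)).prod volume),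
          p.1 ∈ {t | ∀ y, ψ' t y = FunctionSpaces.Torus.timeDeriv ψ t y} :=
        (Measure.quasiMeasurePreserving_fst (μ := (volume : Measure ℝ).restrict (Ioo 0 T))
          (ν := (volume : Measure (UnitAddTorus d)))).ae hψ'eq
      filter_upwards [hset] with p hp
      exact hp p.2
    filter_upwards [hprod] with p hp
    rw [hp]
  exact h.ae_integral_inner_twoMember_eq hψs hψc hψL hψdiv hψ' hG1 hq hadj hint
    (h.integrable_crossIntegrand hψs hψc hG1 hGc hGd hb₂ hR (𝔸 - 𝔸₂))
    (h.integrable_inner_distort_transpose_gradient hGc hqc)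

end IsWeakTensorPassiveVectorDistortedOn

end Integrability

end Torus

end Literature.Analysis.FluidPDE

end
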